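import Summits.BirchSwinnertonDyer.Rank1Residual.Additive.TameBranchOfTwistBranch
import Summits.BirchSwinnertonDyer.Rank1Residual.Additive.TameBranchOfTwistBranchOdd
import Summits.BirchSwinnertonDyer.Rank1Residual.Additive.TameBranchKatoDivisibilityRankOne
import Summits.BirchSwinnertonDyer.Rank1Residual.Additive.GordRankOneKatoCertificateClass
import HarnessLib

/-!
# The typed Kato half `TameBranchRatDvdAt W p` on X4♯(G-ord) / X3♯(G-ord) ∩ `I₀*` at EVERY odd `p`
# DERIVED FROM KATO 2004 Thm. 17.4 (3) / WUTHRICH 2014 Thm. 16 — without Delbourgo 2002 Theorem (C)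
# (sub-cell additive-p2, gen 22; cell `b2b-bsdres`)

HONEST FRAMING (cell `b2b-bsdres`, run/shared/lean/b2b/bsd-rank1-residual/, verbatim in every
file): the goal of the cell is to DELETE the COMBINATION-SHAPED residual classes of the
Birch–Swinnerton-Dyer formula for ALL analytic-rank `≤ 1` elliptic curves over `ℚ` — "full BSD
formula for every rank `≤ 1` curve in class `C`" assembled STRICTLY from published theorems — so
that the rank-`≤ 1` remainder becomes exactly the CONSTRUCTION-SHAPED classes, which are TYPED
(missing-input `Prop`s), NOT attempted. This is not "finishing BSD". Research route on the
CONSTRUCTION-SHAPED classes X3♯(G-ord) / X4♯(G-ord): labels UNCHANGED, NOTHING booked; theorems only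
(no definition, no named fact); every published input is an explicit named-fact binder: `hK` = the
semistable big-image half-eigenspace reading of Kato 2004 Thm. 17.4 (3)
(`Wuthrich2014.kato_halfEigenCharIdeal_dvd_cyclotomicPrime_of_surjective`), `hWu` = Wuthrich 2014
Thm. 16 on the half eigenspace (`Wuthrich2014.thm16_halfEigenCharIdeal_dvd_cyclotomicPrime`),
`hmodD` = modular parametrisations (BCDT), `hDel` = Delbourgo 2002 (A)+(B) (A175), `hGZK`.

## What and why

Gen 20 typed the Euler-system (Kato-direction) half of the tame-branch main conjecture at an additive
potentially-ordinary prime as `TameBranchRatDvdAt W p` (`TameBranchKatoDivisibility.lean`) and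
discharged it on the WHOLE locus `p ≥ 5` from the named fact A227 = Delbourgo 2002 Theorem (C)
(`TameBranchKatoDivisibilityOfDelbourgo.lean`), whose proof in print rests on the interpolating
homomorphisms of Kato–Kurihara–Tsuji "in preparation" (referee flag `Del02-KKT-inprep`). On the
DEFECT-2 rows (`I₀*`: `E = E♭ ⊗ χ_{p*}`, `E♭` good ordinary) at EVERY odd `p` (both parities of
`(p−1)/2`: plus branch at `p ≡ 1 (mod 4)`, minus branch at `p ≡ 3 (mod 4)`) THIS FILE gives a SECOND,
INDEPENDENT discharge from refereed print WITHOUT that dependency: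

  **`TameBranchRatDvdAt W p` ⟸ Kato 2004 Thm. 17.4 (3) (X4, `ρ̄_{E,p}` onto, `p ≥ 5`) resp.
  Wuthrich 2014 Thm. 16 (X3, `E[p]` reducible)** (`ClassX4Gord.tameBranchRatDvdAt_of_katoHalf`,
  `ClassX3Gord.tameBranchRatDvdAt_of_wuthrichHalf`),

by composing three kernel theorems: (i) gen 19's full-series brick
`isTorsion_and_exists_iota_eq_branch_of_katoComponent` / `…_of_wuthrichComponent`
(`ι g = C(u·ϖ)·L_p(f_{E♭}, α, ω^{(p−1)/2}, T)`, via additive-p1's [C] transport and gen 12's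
eigen-descent); (ii) gen 22's POWER-SERIES DICTIONARY `TameBranchOfTwistBranch[Odd].lean` — every
E-normalised tame branch of `(f_E, χ_p, unitRoot E♭ p)` IS `C(c)·L^±_p(f_{E♭}, α, ω^{(p−1)/2}, T)` (the
wild-character interpolation of the MTT branches, `PAdicLFunction[Minus]BranchInterpolationProofs`, +
cc-typer-2's un-twisting and Legendre twist relations); (iii) gen 21's tuple rigidity `IsTameBranchOf.tuple_eq`
(any other tuple `(ε, α, B)` of the package with `α ≠ 0` has `B = 0` or `B =` that series). The
exponent bookkeeping `C(c)·X = C(c/(uϖ))·ι g ⟹ p^k·C(c)·X ∈ ι(char_Λ X)` is §1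
(`exists_mem_iwasawaToPowerSeries_eq_C_pow_mul`, `‖p^k·v‖ ≤ 1` for `k ≫ 0`).

§3 re-derives gen 20's headline consumers on these rows with A227 replaced by Kato/Wuthrich:
`ClassX4Gord.charLamLeAt_of_katoHalf_of_cert`, `ClassX4Gord.schneider_rankOne_of_katoHalf_of_tameCert`
and the X3 twins — the λ-certificate and Schneider's conjecture at rank one from Kato + Delbourgo (A)+(B)
+ GZK + ONE integral E-normalised tame branch with a unit linear coefficient (gen 19 obtained the same
from the `ϖ`-normalised certificate `BranchUnitCertificateAt`; by the dictionary the two certificates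
are one computation).

What is NOT claimed: the (M) rows (one-term measure; the AdditivePotMult bricks), defect `3,4,6` (Kato
17.4 does not reach Delbourgo's `f̃`), `p = 3` on X4 (the big-image brick needs `p ≥ 5`), `μ`, any
booking. Labels UNCHANGED.

References: [Kato2004Asterisque] Thm. 17.4 (3) (p. 273); [Wuthrich2014] Thm. 16 (p. 397);
[Delbourgo2002] Thm. (A)–(C) (p. 40); [MazurTateTeitelbaum1986Invent] §I.13–I.14;
[GreenbergLNM1716] §5; `Additive/TameBranchKatoDivisibility{,RankOne,OfDelbourgo}.lean` (gen 20),
`Additive/GordRankOneKatoCertificate{,Class}.lean` (gen 19), `Additive/TameBranchRigidity.lean` (gen 21),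
`Additive/TameBranchOfTwistBranch[Odd].lean` (gen 22).
-/

noncomputable section

open scoped Classical MatrixGroups ModularForm NumberField

open CongruenceSubgroup WeierstrassCurve NumberField Literature.NumberTheory.EllipticCurves
  Literature.NumberTheory.EllipticCurves.ModularForms
  Literature.NumberTheory.EllipticCurves.Rank1Residual
  Literature.NumberTheory.EllipticCurves.Rank1Residual.Typed
  Literature.NumberTheory.EllipticCurves.Delbourgo2002
  Literature.NumberTheory.GaloisRepresentations
  IsDedekindDomain

namespace Summit.BirchSwinnertonDyer.Rank1Residual.Additive

/-! ### §1 Exponent bookkeeping in `Λ ⊗ ℚ_p` -/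

section Algebra

variable {p : ℕ} [hp : Fact p.Prime]

/-- **From `ι g = C(v)·X` (`g` in an ideal `I` of `Λ`, `v ∈ ℚ_p^×`) to `p^k·(C(c)·X) ∈ ι(I)`.**
`C(c)·X = C(c·v⁻¹)·ι g`, and for `k` large `p^k·c·v⁻¹ ∈ ℤ_p` (`‖p‖ = p⁻¹ < 1`), so
`p^k·C(c)·X = ι(C(p^k c v⁻¹)·g)` with `C(p^k c v⁻¹)·g ∈ I`. Pure bookkeeping. [folklore] -/
theorem exists_mem_iwasawaToPowerSeries_eq_C_pow_mul {I : Ideal (IwasawaAlgebra p)}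
    {g : IwasawaAlgebra p} (hg : g ∈ I) {X : PowerSeries ℚ_[p]} {v : ℚ_[p]} (hv : v ≠ 0)
    (hι : iwasawaToPowerSeries p g = PowerSeries.C v * X) (c : ℚ_[p]) :
    ∃ g' ∈ I, ∃ k : ℕ,
      iwasawaToPowerSeries p g' = PowerSeries.C ((p : ℚ_[p]) ^ k) * (PowerSeries.C c * X) := by
  have hp1 : (1 : ℝ) < p := by exact_mod_cast hp.out.one_lt
  set w : ℚ_[p] := c * v⁻¹ with hw
  -- `p^k · w ∈ ℤ_p` for `k` large
  obtain ⟨k, hk⟩ := pow_unbounded_of_one_lt ‖w‖ hp1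
  have hy : ‖(p : ℚ_[p]) ^ k * w‖ ≤ 1 := by
    rw [norm_mul, norm_pow, Padic.norm_p, inv_pow]
    have hpk : (0 : ℝ) < (p : ℝ) ^ k := pow_pos (by exact_mod_cast hp.out.pos) k
    rw [inv_mul_le_iff₀ hpk, mul_one]
    exact hk.le
  refine ⟨PowerSeries.C (R := ℤ_[p]) ⟨(p : ℚ_[p]) ^ k * w, hy⟩ * g, I.mul_mem_left _ hg, k, ?_⟩
  have hX : X = PowerSeries.C v⁻¹ * iwasawaToPowerSeries p g := by
    rw [hι, ← mul_assoc, ← map_mul, inv_mul_cancel₀ hv, map_one, one_mul]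
  have hφ : algebraMap ℤ_[p] ℚ_[p] ⟨(p : ℚ_[p]) ^ k * w, hy⟩ = (p : ℚ_[p]) ^ k * (c * v⁻¹) := rfl
  rw [map_mul, PowerSeries.map_C, hX, hφ]
  simp only [map_mul]
  ring

end Algebra

/-! ### §2 The typed Kato half from Kato 17.4 (3) / Wuthrich 16 on the defect-2 rows, `p ≡ 1 (mod 4)` -/

section KatoHalf

variable {W : WeierstrassCurve ℚ} [W.IsElliptic] [W.IsGloballyMinimal] {p : ℕ} [hp : Fact p.Prime]

omit [W.IsGloballyMinimal] in
/-- **Core step, model level, even branch (`p ≡ 1 (mod 4)`).** `E = W` additive at `p`, `V = E♭`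
globally minimal GOOD ORDINARY at `p` with `C • V^{(p)} = W`, `g` the newform of `V`, `f` the newform of
`W`; suppose ONE element `g₁` of an ideal `I ⊆ Λ` has `ι g₁ = C(v)·L_p(g, unitRoot V p, ω^{(p−1)/2}, T)`
with `v ≠ 0` (the shape of the Kato / Wuthrich component brick). Then for EVERY tuple `(ε, α, B)` of
cc-typer-2's package `IsTameBranchOf f p ε α B` (no condition on `ε`, `α`): `ι g' = p^k·B` for some
`g' ∈ I`, `k ∈ ℕ` — by the dictionary (`isTameBranchOf_legendre_C_mul_padicLFunctionBranch` +
`exists_legendreTwistPlusRel_of_twist`), tuple rigidity (`IsTameBranchOf.tuple_eq`: `B = 0` or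
`B = C(c)·L_p(g, α, ω^{(p−1)/2}, T)`) and §1. [cite: MazurTateTeitelbaum1986Invent, §I.13–I.14 (14.3)] -/
theorem exists_mem_iota_eq_C_pow_mul_of_isTameBranchOf_of_iota_eq_branch (hp4 : p % 4 = 1)
    (V : WeierstrassCurve ℚ) [V.IsElliptic] [V.IsGloballyMinimal]
    (hVW : ∃ C : VariableChange ℚ, C • V.quadraticTwist (p : ℚ) = W) (hadd : Addv W p)
    (hord : GoodOrd V p) {N N' : ℕ} [NeZero N] [NeZero N'] {f : CuspForm (Gamma0 N) 2}
    {g : CuspForm (Gamma0 N') 2} (hf : IsNewformOf W f) (hg : IsNewformOf V g)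
    {I : Ideal (IwasawaAlgebra p)} {g₁ : IwasawaAlgebra p} (hg₁ : g₁ ∈ I) {v : ℚ_[p]} (hv : v ≠ 0)
    (hι : iwasawaToPowerSeries p g₁ =
      PowerSeries.C v * padicLFunctionBranch g (unitRoot V p : ℚ_[p]) (p / 2))
    {ε : DirichletCharacter ℂ_[p] p} {α : ℚ_[p]} {B : PowerSeries ℚ_[p]}
    (hB : IsTameBranchOf f p ε α B) :
    ∃ g' ∈ I, ∃ k : ℕ, iwasawaToPowerSeries p g' = PowerSeries.C ((p : ℚ_[p]) ^ k) * B := by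
  have hp2 : p ≠ 2 := (ne_two_and_legendreSym_neg_one_of_mod_four_eq_one (p := p) hp4).1
  have hordV : IsOrdinaryAt V p := (isOrdinaryAt_iff V p).mpr hord
  obtain ⟨c, hrel⟩ := exists_legendreTwistPlusRel_of_twist hp4 V W hVW hadd hf hg
  have hdict := isTameBranchOf_legendre_C_mul_padicLFunctionBranch V hp2 hordV hg hrel
  by_cases hB0 : B = 0
  · refine ⟨0, I.zero_mem, 0, ?_⟩
    rw [hB0, map_zero, mul_zero]
  · obtain ⟨-, -, hBeq⟩ := hB.tuple_eq hp2 hdict hB0 (unitRoot_coe_spec hordV).2.2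
    obtain ⟨g', hg', k, hk⟩ := exists_mem_iwasawaToPowerSeries_eq_C_pow_mul hg₁ hv hι (c : ℚ_[p])
    exact ⟨g', hg', k, by rw [hk, hBeq]⟩

omit [W.IsGloballyMinimal] in
/-- **Core step, model level, odd branch (`p ≡ 3 (mod 4)`)**: the same with `C • V^{(−p)} = W` and the
MINUS branch `L⁻_p(g, unitRoot V p, ω^{(p−1)/2}, T)` (`isTameBranchOf_legendre_C_mul_padicLFunctionMinusBranch`
+ `exists_legendreTwistMinusRel_of_twist`). [cite: MazurTateTeitelbaum1986Invent, §I.13–I.14 (14.3)] -/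
theorem exists_mem_iota_eq_C_pow_mul_of_isTameBranchOf_of_iota_eq_minusBranch (hp4 : p % 4 = 3)
    (V : WeierstrassCurve ℚ) [V.IsElliptic] [V.IsGloballyMinimal]
    (hVW : ∃ C : VariableChange ℚ, C • V.quadraticTwist (-(p : ℚ)) = W) (hadd : Addv W p)
    (hord : GoodOrd V p) {N N' : ℕ} [NeZero N] [NeZero N'] {f : CuspForm (Gamma0 N) 2}
    {g : CuspForm (Gamma0 N') 2} (hf : IsNewformOf W f) (hg : IsNewformOf V g)
    {I : Ideal (IwasawaAlgebra p)} {g₁ : IwasawaAlgebra p} (hg₁ : g₁ ∈ I) {v : ℚ_[p]} (hv : v ≠ 0)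
    (hι : iwasawaToPowerSeries p g₁ =
      PowerSeries.C v * padicLFunctionMinusBranch g (unitRoot V p : ℚ_[p]) (p / 2))
    {ε : DirichletCharacter ℂ_[p] p} {α : ℚ_[p]} {B : PowerSeries ℚ_[p]}
    (hB : IsTameBranchOf f p ε α B) :
    ∃ g' ∈ I, ∃ k : ℕ, iwasawaToPowerSeries p g' = PowerSeries.C ((p : ℚ_[p]) ^ k) * B := by
  have hp2 : p ≠ 2 := (ne_two_and_legendreSym_neg_one_of_mod_four_eq_three (p := p) hp4).1
  have hordV : IsOrdinaryAt V p := (isOrdinaryAt_iff V p).mpr hord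
  obtain ⟨c, hrel⟩ := exists_legendreTwistMinusRel_of_twist hp4 V W hVW hadd hf hg
  have hdict := isTameBranchOf_legendre_C_mul_padicLFunctionMinusBranch V hp2 hordV hg hrel
  by_cases hB0 : B = 0
  · refine ⟨0, I.zero_mem, 0, ?_⟩
    rw [hB0, map_zero, mul_zero]
  · obtain ⟨-, -, hBeq⟩ := hB.tuple_eq hp2 hdict hB0 (unitRoot_coe_spec hordV).2.2
    obtain ⟨g', hg', k, hk⟩ := exists_mem_iwasawaToPowerSeries_eq_C_pow_mul hg₁ hv hι (c : ℚ_[p])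
    exact ⟨g', hg', k, by rw [hk, hBeq]⟩

omit [W.IsGloballyMinimal] in
/-- **Both parities glued, model level.** `W` additive at the odd prime `p`, `V = E♭` globally minimal
good ordinary with `C • V^{(p*)} = W` (`p* = (−1)^{(p−1)/2}p`), `f` the newform of `W`, `Dm` modular
parametrisation data of `V` (newform `Dm.f`), `D` a cyclotomic dual datum of `Sel_{p^∞}(W/ℚ_∞)`; suppose
the COMPONENT BRICK holds for `D` — for every period ratio `ϖ` of the parity of `(p−1)/2`, `X` is torsion
and some `g ∈ char_Λ X` has `ι g = C(u·ϖ)·B^±_{(p−1)/2}(Dm.f, unitRoot V p)` (gen 19's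
`isTorsion_and_exists_iota_eq_branch_of_katoComponent` / `…_of_wuthrichComponent`). Then for EVERY
tuple `(ε, α, B)` of the package for `f`: `X` is torsion and `p^k·B ∈ ι(char_Λ X)` — the conclusion of
`TameBranchRatDvdAt`. (The period ratio is taken POSITIVE, `exists_rat_mul_realPeriodRat_eq_plusPeriod` /
`exists_rat_mul_imaginaryPeriodRat_eq_minusPeriod`, so `u·ϖ ≠ 0`.) [cite: MazurTateTeitelbaum1986Invent, §I.13–I.14 (14.3)] -/
theorem isTorsion_and_exists_mem_iota_eq_C_pow_mul_of_componentBrick (hp2 : p ≠ 2)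
    (V : WeierstrassCurve ℚ) [V.IsElliptic] [V.IsGloballyMinimal] (C : VariableChange ℚ)
    (hC : C • V.quadraticTwist ((-1 : ℚ) ^ (p / 2) * p) = W) (hadd : Addv W p) (hord : GoodOrd V p)
    {N N' : ℕ} [NeZero N] [NeZero N'] {f : CuspForm (Gamma0 N) 2} (hf : IsNewformOf W f)
    (Dm : ModularParametrizationData V N')
    {κ : ZpExtension ℚ p} {γ : Field.absoluteGaloisGroup ℚ} {D : W.SelmerDualData κ γ}
    (hbrick : ∀ ϖ : ℚ, (if Even (p / 2) then (ϖ : ℝ) * V.realPeriodRat = plusPeriod Dm.f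
        else (ϖ : ℝ) * V.imaginaryPeriodRat = minusPeriod Dm.f) →
      D.IsTorsion ∧ ∃ g ∈ D.charIdeal, ∃ u : ℤ_[p]ˣ,
        iwasawaToPowerSeries p g =
          PowerSeries.C (((u : ℤ_[p]) : ℚ_[p]) * (ϖ : ℚ_[p])) *
            (if Even (p / 2) then padicLFunctionBranch Dm.f ((unitRoot V p : ℤ_[p]) : ℚ_[p]) (p / 2)
              else padicLFunctionMinusBranch Dm.f ((unitRoot V p : ℤ_[p]) : ℚ_[p]) (p / 2)))
    {ε : DirichletCharacter ℂ_[p] p} {α : ℚ_[p]} {B : PowerSeries ℚ_[p]}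
    (hB : IsTameBranchOf f p ε α B) :
    D.IsTorsion ∧ ∃ g' ∈ D.charIdeal, ∃ k : ℕ,
      iwasawaToPowerSeries p g' = PowerSeries.C ((p : ℚ_[p]) ^ k) * B := by
  have hodd : p % 4 = 1 ∨ p % 4 = 3 := by
    obtain ⟨k, hk⟩ := hp.out.odd_of_ne_two hp2
    omega
  rcases hodd with h1 | h3
  · have heven : Even (p / 2) := ⟨p / 4, by omega⟩
    obtain ⟨ϖ, hϖ0, hϖ, -⟩ := Dm.exists_rat_mul_realPeriodRat_eq_plusPeriod
    obtain ⟨hXt, g₁, hg₁, u, hι⟩ := hbrick ϖ (by rw [if_pos heven]; exact hϖ)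
    rw [if_pos heven] at hι
    have hC' : C • V.quadraticTwist (p : ℚ) = W := by
      rw [pStar_eq_of_mod_four p (Or.inl h1), if_pos h1] at hC
      exact hC
    have hv : (((u : ℤ_[p]) : ℚ_[p]) * (ϖ : ℚ_[p])) ≠ 0 :=
      mul_ne_zero (PadicInt.coe_ne_zero.mpr u.ne_zero) (by exact_mod_cast hϖ0.ne')
    exact ⟨hXt, exists_mem_iota_eq_C_pow_mul_of_isTameBranchOf_of_iota_eq_branch h1 V ⟨C, hC'⟩ hadd
      hord hf Dm.isNewformOf hg₁ hv hι hB⟩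
  · have hnot : ¬ Even (p / 2) := by rw [Nat.not_even_iff_odd]; exact ⟨p / 4, by omega⟩
    obtain ⟨ϖ, hϖ0, hϖ⟩ := exists_rat_mul_imaginaryPeriodRat_eq_minusPeriod Dm
    obtain ⟨hXt, g₁, hg₁, u, hι⟩ := hbrick ϖ (by rw [if_neg hnot]; exact hϖ)
    rw [if_neg hnot] at hι
    have hC' : C • V.quadraticTwist (-(p : ℚ)) = W := by
      rw [pStar_eq_of_mod_four p (Or.inr h3), if_neg (by omega)] at hC
      exact hC
    have hv : (((u : ℤ_[p]) : ℚ_[p]) * (ϖ : ℚ_[p])) ≠ 0 :=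
      mul_ne_zero (PadicInt.coe_ne_zero.mpr u.ne_zero) (by exact_mod_cast hϖ0.ne')
    exact ⟨hXt, exists_mem_iota_eq_C_pow_mul_of_isTameBranchOf_of_iota_eq_minusBranch h3 V ⟨C, hC'⟩
      hadd hord hf Dm.isNewformOf hg₁ hv hι hB⟩

/-- **X4♯(G-ord) ∩ `I₀*` ∩ {`ρ̄_{E,p}` onto}, EVERY `p ≥ 5`: the typed Kato half `TameBranchRatDvdAt W p`
is a THEOREM of Kato 2004 Thm. 17.4 (3)** (semistable big-image component reading `hK`, via
`Kato2004.charIdeal_dvd_padicLFunctionBranch_component_of_surjective_of_half`) and BCDT modular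
parametrisations (`hmodD`, for the newform of `E♭`) — NO Delbourgo 2002 (C), no `Del02-KKT-inprep`
dependency. For every tuple `(f, ε, α, B)` of the package and every cyclotomic dual datum: `X(E/ℚ_∞)`
is `Λ`-torsion and `p^k·B ∈ ι(char_Λ X(E/ℚ_∞))`. Chain: good-ordinary twist model
(`ClassX4Gord.exists_goodOrd_pStar_twist_model`), Serre lifting (`forall_surj_pow_twist_of_surj`),
gen 19's brick `isTorsion_and_exists_iota_eq_branch_of_katoComponent`, and
`isTorsion_and_exists_mem_iota_eq_C_pow_mul_of_componentBrick` (dictionary + rigidity + §1, both parities).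
[cite: Kato2004Asterisque, Thm. 17.4 (3) (p. 273)] [cite: MazurTateTeitelbaum1986Invent, §I.13–I.14] -/
theorem ClassX4Gord.tameBranchRatDvdAt_of_katoHalf
    (hK : Wuthrich2014.kato_halfEigenCharIdeal_dvd_cyclotomicPrime_of_surjective)
    (hmodD : nonempty_modularParametrizationData)
    (hX : ClassX4Gord W p) (hp5 : 5 ≤ p) (he : semistabilityIndex W p = 2) (hsurj : Surj W p) :
    TameBranchRatDvdAt W p := by
  intro κ γ N _ f ε α B hp2 hadd _ hκ hγ hcv hf _ _ hB D
  obtain ⟨V, iV, iVm, C, hV, hC⟩ := hX.exists_goodOrd_pStar_twist_model W p he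
  haveI : NeZero (V.conductorNorm ℤ) := ⟨(V.conductorNorm_pos_holds).ne'⟩
  obtain ⟨Dm⟩ := hmodD V
  have hj := padicValRat_j_nonneg_of_typeGOrd W p hX.typeGOrd
  have hsurjV : ∀ n : ℕ, V.HasSurjectiveModNGaloisRep (p ^ n : ℕ) :=
    X4RankZeroTwistOdd.forall_surj_pow_twist_of_surj W p hp5 V (pStar_ne_zero p) C hC hsurj
  exact isTorsion_and_exists_mem_iota_eq_C_pow_mul_of_componentBrick hp2 V C hC hadd hV hf Dm
    (fun ϖ hϖ ↦ isTorsion_and_exists_iota_eq_branch_of_katoComponent W p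
      (Kato2004.charIdeal_dvd_padicLFunctionBranch_component_of_surjective_of_half hK) hj hp2 V
      ⟨C, hC⟩ (Or.inl hV) hsurjV hκ hγ hcv Dm.isNewformOf D ϖ hϖ) hB

/-- **X3♯(G-ord) ∩ `I₀*`, EVERY odd `p`: `TameBranchRatDvdAt W p` is a THEOREM of Wuthrich 2014
Thm. 16** (semistable reducible component reading `hWu`, via
`Wuthrich2014.charIdeal_dvd_padicLFunctionBranch_component_of_half`) and `hmodD` — again without
Delbourgo 2002 (C). [cite: Wuthrich2014, Thm. 16 (p. 397)] [cite: MazurTateTeitelbaum1986Invent, §I.13–I.14] -/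
theorem ClassX3Gord.tameBranchRatDvdAt_of_wuthrichHalf
    (hWu : Wuthrich2014.thm16_halfEigenCharIdeal_dvd_cyclotomicPrime)
    (hmodD : nonempty_modularParametrizationData)
    (hX : ClassX3Gord W p) (he : semistabilityIndex W p = 2) : TameBranchRatDvdAt W p := by
  intro κ γ N _ f ε α B hp2 hadd _ hκ hγ hcv hf _ _ hB D
  obtain ⟨V, iV, iVm, C, hV, hC⟩ := hX.exists_goodOrd_pStar_twist_model W p hp2 he
  haveI : NeZero (V.conductorNorm ℤ) := ⟨(V.conductorNorm_pos_holds).ne'⟩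
  obtain ⟨Dm⟩ := hmodD V
  have hj := padicValRat_j_nonneg_of_typeGOrd W p hX.typeGOrd
  exact isTorsion_and_exists_mem_iota_eq_C_pow_mul_of_componentBrick hp2 V C hC hadd hV hf Dm
    (fun ϖ hϖ ↦ isTorsion_and_exists_iota_eq_branch_of_wuthrichComponent W p
      (Wuthrich2014.charIdeal_dvd_padicLFunctionBranch_component_of_half hWu) hj hp2 V
      ⟨C, hC⟩ (Or.inl hV) hX.classX3.1 hκ hγ hcv Dm.isNewformOf D ϖ hϖ) hB

end KatoHalf

/-! ### §3 Gen 20's headlines on these rows with A227 replaced by Kato / Wuthrich -/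

section Headlines

variable {W : WeierstrassCurve ℚ} [W.IsElliptic] [W.IsGloballyMinimal] {p : ℕ} [hp : Fact p.Prime]

/-- **X4♯(G-ord) ∩ `I₀*` ∩ {`ρ̄` onto}, `p ≥ 5`: n1011-p01's λ-certificate `CharLamLeAt W p n` from
Kato 17.4 (3) and ONE integral E-normalised tame branch with a unit coefficient at index `n`** (gen 20's `charLamLeAt_of_tameBranchRatDvdAt_of_integral_of_norm_coeff_eq_one`
with its typed input discharged by `ClassX4Gord.tameBranchRatDvdAt_of_katoHalf`).
[cite: Kato2004Asterisque, Thm. 17.4 (3) (p. 273)] [cite: Washington1997, §7.1] -/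
theorem ClassX4Gord.charLamLeAt_of_katoHalf_of_tameCert
    (hK : Wuthrich2014.kato_halfEigenCharIdeal_dvd_cyclotomicPrime_of_surjective)
    (hmodD : nonempty_modularParametrizationData)
    (hX : ClassX4Gord W p) (hp5 : 5 ≤ p) (he : semistabilityIndex W p = 2) (hsurj : Surj W p)
    {N : ℕ} [NeZero N] {f : CuspForm (Gamma0 N) 2} {ε : DirichletCharacter ℂ_[p] p} {α : ℚ_[p]}
    {B : PowerSeries ℚ_[p]}
    (hf : IsNewformOf W f) (hε : orderOf ε = tameDefect W p) (hα : ‖α‖ = 1)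
    (hB : IsTameBranchOf f p ε α B) (hint : ∀ j : ℕ, ‖PowerSeries.coeff j B‖ ≤ 1)
    {n : ℕ} (hn : ‖PowerSeries.coeff n B‖ = 1) : CharLamLeAt W p n :=
  charLamLeAt_of_tameBranchRatDvdAt_of_integral_of_norm_coeff_eq_one
    (hX.tameBranchRatDvdAt_of_katoHalf hK hmodD hp5 he hsurj) (by omega) hX.1.2.1 (Or.inr hX.2) hf hε
    hα hB hint hn

/-- **X3♯(G-ord) ∩ `I₀*`, odd `p` twin**: `CharLamLeAt W p n` from Wuthrich Thm. 16 and ONE certified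
E-normalised tame branch. [cite: Wuthrich2014, Thm. 16 (p. 397)] [cite: Washington1997, §7.1] -/
theorem ClassX3Gord.charLamLeAt_of_wuthrichHalf_of_tameCert
    (hWu : Wuthrich2014.thm16_halfEigenCharIdeal_dvd_cyclotomicPrime)
    (hmodD : nonempty_modularParametrizationData)
    (hX : ClassX3Gord W p) (hp2 : p ≠ 2) (he : semistabilityIndex W p = 2)
    {N : ℕ} [NeZero N] {f : CuspForm (Gamma0 N) 2} {ε : DirichletCharacter ℂ_[p] p} {α : ℚ_[p]}
    {B : PowerSeries ℚ_[p]}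
    (hf : IsNewformOf W f) (hε : orderOf ε = tameDefect W p) (hα : ‖α‖ = 1)
    (hB : IsTameBranchOf f p ε α B) (hint : ∀ j : ℕ, ‖PowerSeries.coeff j B‖ ≤ 1)
    {n : ℕ} (hn : ‖PowerSeries.coeff n B‖ = 1) : CharLamLeAt W p n :=
  charLamLeAt_of_tameBranchRatDvdAt_of_integral_of_norm_coeff_eq_one
    (hX.tameBranchRatDvdAt_of_wuthrichHalf hWu hmodD he) hp2 hX.addv (Or.inr hX.typeGOrd) hf hε hα
    hB hint hn

/-- **X4♯(G-ord) ∩ `I₀*` ∩ {`ρ̄` onto}, `p ≥ 5`, non-CM, `ord_{s=1}L(E,s) = 1`: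
Schneider's `Reg_p(E,Dh) ≠ 0` for every height datum with Delbourgo's (B)-clauses, from Kato 17.4 (3)
+ Delbourgo 2002 (A)+(B) + Gross–Zagier–Kolyvagin + ONE integral E-normalised tame branch with
`‖[T¹]B‖_p = 1`** (gen 20's `ClassX4Gord.schneider_rankOne_of_tameBranchRatDvdAt_of_cert` with the
typed input discharged by Kato; gen 19 reached the same conclusion from the `ϖ`-normalised certificate
`BranchUnitCertificateAt` — by the dictionary the two certificates are one computation).
[cite: Kato2004Asterisque, Thm. 17.4 (3) (p. 273)] [cite: Delbourgo2002, Theorem (A), (B) (p. 40)] -/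
theorem ClassX4Gord.schneider_rankOne_of_katoHalf_of_tameCert
    (hK : Wuthrich2014.kato_halfEigenCharIdeal_dvd_cyclotomicPrime_of_surjective)
    (hmodD : nonempty_modularParametrizationData) (hDel : Delbourgo2002.mainTheorem)
    (hGZK : rank_eq_analyticRank_of_analyticRank_le_one)
    (hX : ClassX4Gord W p) (hp5 : 5 ≤ p) (he : semistabilityIndex W p = 2)
    (hsurj : Surj W p) (hcm : ¬ W.HasCM) (hr : W.analyticRank = 1)
    {N : ℕ} [NeZero N] {f : CuspForm (Gamma0 N) 2} {ε : DirichletCharacter ℂ_[p] p} {α : ℚ_[p]}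
    {B : PowerSeries ℚ_[p]}
    (hf : IsNewformOf W f) (hε : orderOf ε = tameDefect W p) (hα : ‖α‖ = 1)
    (hB : IsTameBranchOf f p ε α B) (hint : ∀ j : ℕ, ‖PowerSeries.coeff j B‖ ≤ 1)
    (h1 : ‖PowerSeries.coeff 1 B‖ = 1)
    {Dh : PAdicHeightData W p} (hBcl : LeadingTermClauses W p Dh) : SchneiderConjecture Dh :=
  hX.schneider_rankOne_of_tameBranchRatDvdAt_of_cert hDel hGZK
    (hX.tameBranchRatDvdAt_of_katoHalf hK hmodD hp5 he hsurj) hp5 hcm hr hf hε hα hB hint h1 hBcl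

/-- **X3♯(G-ord) ∩ `I₀*`, `p ≥ 5`, non-CM, `r_an = 1` twin**: Schneider for every
(B)-datum from Wuthrich Thm. 16 + Delbourgo 2002 (A)+(B) + GZK + ONE certified E-normalised tame branch.
[cite: Wuthrich2014, Thm. 16 (p. 397)] [cite: Delbourgo2002, Theorem (A), (B) (p. 40)] -/
theorem ClassX3Gord.schneider_rankOne_of_wuthrichHalf_of_tameCert
    (hWu : Wuthrich2014.thm16_halfEigenCharIdeal_dvd_cyclotomicPrime)
    (hmodD : nonempty_modularParametrizationData) (hDel : Delbourgo2002.mainTheorem)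
    (hGZK : rank_eq_analyticRank_of_analyticRank_le_one)
    (hX : ClassX3Gord W p) (hp5 : 5 ≤ p) (he : semistabilityIndex W p = 2)
    (hcm : ¬ W.HasCM) (hr : W.analyticRank = 1)
    {N : ℕ} [NeZero N] {f : CuspForm (Gamma0 N) 2} {ε : DirichletCharacter ℂ_[p] p} {α : ℚ_[p]}
    {B : PowerSeries ℚ_[p]}
    (hf : IsNewformOf W f) (hε : orderOf ε = tameDefect W p) (hα : ‖α‖ = 1)
    (hB : IsTameBranchOf f p ε α B) (hint : ∀ j : ℕ, ‖PowerSeries.coeff j B‖ ≤ 1)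
    (h1 : ‖PowerSeries.coeff 1 B‖ = 1)
    {Dh : PAdicHeightData W p} (hBcl : LeadingTermClauses W p Dh) : SchneiderConjecture Dh :=
  hX.schneider_rankOne_of_tameBranchRatDvdAt_of_cert hDel hGZK
    (hX.tameBranchRatDvdAt_of_wuthrichHalf hWu hmodD he) hp5 hcm hr hf hε hα hB hint h1 hBcl

end Headlines

end Summit.BirchSwinnertonDyer.Rank1Residual.Additive

end
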